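import Literature.AnabelianGeometry.AbsoluteAnabelian.AutHolomorphicSpaces
import Literature.Analysis.Complex.UnitDiscAutomorphisms
import Mathlib.Geometry.Manifold.MFDeriv.Atlas
import Mathlib.Geometry.Manifold.MFDeriv.FDeriv
import Mathlib.Analysis.Calculus.Deriv.Star
import HarnessLib

/-!
# Transport lemmas for Aut-holomorphic discs (PROOF-ONLY support for [AbsTopIII] Prop. 2.2)

Bookkeeping between the three presentations of the unit disc that occur in the typed statement
of [AbsTopIII] Prop. 2.2 (i) (`DiscAutHolIsoIsRCHolomorphic` in `AutHolomorphicSpaces`): an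
abstract Riemann surface `X` with `IsAutHolDisc X`, the open subset `unitDiscOpens : Opens ℂ` with
its charted-space structure, and total functions `ℂ → ℂ` on which the complex analysis of
`Literature/Analysis/Complex/UnitDisc*.lean` is phrased.  Contents (all theorems, no definitions):

* `mdifferentiableAt_opens_iff` and variants — `MDifferentiableAt` for maps between open
  subtypes versus the ambient maps (Mathlib's `liftPropAt_iff_comp_subtype_val` /
  `liftPropWithinAt_subtypeVal_comp_iff` specialised to differentiability);
* `differentiableOn_extend_of_mdifferentiable` / `mdifferentiable_of_differentiableOn` — maps
  `unitDiscOpens → unitDiscOpens` versus holomorphic functions on the ball;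
* `exists_homeomorph_unitDiscOpens_of_isDiscAut` — an automorphism of the disc
  (`Literature.Analysis.Complex.IsDiscAut`) as a biholomorphic self-homeomorphism of `unitDiscOpens`;
* `exists_homeomorph_top` — restriction of a self-homeomorphism of `X` to `⊤ : Opens X`;
* `isConnected_top_of_isAutHolDisc` — an Aut-holomorphic disc is connected.

[cite: MochizukiAbsTopIII2015, Proposition 2.2 (i) p.52]
-/

noncomputable section

namespace Literature.AnabelianGeometry.AbsoluteAnabelian

open _root_.TopologicalSpace _root_.Topology _root_.Set _root_.Metric _root_.Function
open scoped _root_.Manifold _root_.ContDiff ComplexConjugate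
open Literature.Analysis.Complex

/-! ### `MDifferentiableAt` and open subtypes -/

section Subtype

variable {M M' : Type*} [TopologicalSpace M] [ChartedSpace ℂ M] [TopologicalSpace M']
  [ChartedSpace ℂ M']

/-- A map between open subtypes is `ℂ`-differentiable at a point iff the ambient map it restricts
is. [cite: MochizukiAbsTopIII2015, Definition 2.1 (i) p.50] -/
theorem mdifferentiableAt_opens_iff {U : Opens M} {V : Opens M'} {Φ : M → M'} {Ψ : U → V}
    (hΨ : ∀ x, (Ψ x : M') = Φ x) (x : U) :
    MDifferentiableAt 𝓘(ℂ, ℂ) 𝓘(ℂ, ℂ) Ψ x ↔ MDifferentiableAt 𝓘(ℂ, ℂ) 𝓘(ℂ, ℂ) Φ x := by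
  have h1 : (Subtype.val ∘ Ψ) = Φ ∘ Subtype.val := funext hΨ
  have e1 : MDifferentiableAt 𝓘(ℂ, ℂ) 𝓘(ℂ, ℂ) Ψ x ↔
      MDifferentiableAt 𝓘(ℂ, ℂ) 𝓘(ℂ, ℂ) (Subtype.val ∘ Ψ) x :=
    (ChartedSpace.liftPropWithinAt_subtypeVal_comp_iff Ψ univ x).symm
  have e2 : MDifferentiableAt 𝓘(ℂ, ℂ) 𝓘(ℂ, ℂ) (Φ ∘ Subtype.val) x ↔
      MDifferentiableAt 𝓘(ℂ, ℂ) 𝓘(ℂ, ℂ) Φ x :=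
    ((differentiableWithinAt_localInvariantProp (I := 𝓘(ℂ, ℂ))
      (I' := 𝓘(ℂ, ℂ))).liftPropAt_iff_comp_subtype_val Φ x).symm
  rw [e1, h1, e2]

/-- A map out of an open subtype is `ℂ`-differentiable at a point iff the ambient map it
restricts is. [cite: MochizukiAbsTopIII2015, Definition 2.1 (i) p.50] -/
theorem mdifferentiableAt_opens_dom_iff {U : Opens M} {Φ : M → M'} {Ψ : U → M'}
    (hΨ : ∀ x, Ψ x = Φ x) (x : U) :
    MDifferentiableAt 𝓘(ℂ, ℂ) 𝓘(ℂ, ℂ) Ψ x ↔ MDifferentiableAt 𝓘(ℂ, ℂ) 𝓘(ℂ, ℂ) Φ x := by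
  have h1 : Ψ = Φ ∘ Subtype.val := funext hΨ
  rw [h1]
  exact ((differentiableWithinAt_localInvariantProp (I := 𝓘(ℂ, ℂ))
    (I' := 𝓘(ℂ, ℂ))).liftPropAt_iff_comp_subtype_val Φ x).symm

/-- A map into an open subtype is `ℂ`-differentiable at a point iff its composite with the
inclusion is. [cite: MochizukiAbsTopIII2015, Definition 2.1 (i) p.50] -/
theorem mdifferentiableAt_opens_cod_iff {V : Opens M'} {Ψ : M → V} (x : M) :
    MDifferentiableAt 𝓘(ℂ, ℂ) 𝓘(ℂ, ℂ) Ψ x ↔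
      MDifferentiableAt 𝓘(ℂ, ℂ) 𝓘(ℂ, ℂ) (Subtype.val ∘ Ψ) x :=
  (ChartedSpace.liftPropWithinAt_subtypeVal_comp_iff Ψ univ x).symm

end Subtype

/-! ### The open unit disc: subtype versus total functions -/

/-- Membership in `unitDiscOpens`. [cite: MochizukiAbsTopIII2015, Definition 2.1 (i) p.50] -/
theorem mem_unitDiscOpens {z : ℂ} : z ∈ unitDiscOpens ↔ ‖z‖ < 1 := by
  show z ∈ ball (0 : ℂ) 1 ↔ _
  exact mem_ball_zero_iff

/-- Points of `unitDiscOpens` lie in the ball. [cite: MochizukiAbsTopIII2015, Definition 2.1 (i) p.50] -/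
theorem coe_mem_ball (x : unitDiscOpens) : (x : ℂ) ∈ ball (0 : ℂ) 1 := x.2

/-- Points of `unitDiscOpens` have norm `< 1`. [cite: MochizukiAbsTopIII2015, Definition 2.1 (i) p.50] -/
theorem norm_coe_lt_one (x : unitDiscOpens) : ‖(x : ℂ)‖ < 1 := mem_unitDiscOpens.1 x.2

/-- The total extension (by `0`) of a map `S` out of `unitDiscOpens` agrees with `S` on the disc.
[cite: MochizukiAbsTopIII2015, Definition 2.1 (i) p.50] -/
theorem extend_apply_coe {β : Type*} (S : unitDiscOpens → β) (b : β) (x : unitDiscOpens) :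
    Function.extend Subtype.val S (fun _ => b) x = S x :=
  Subtype.val_injective.extend_apply _ _ x

/-- The total extension of `S` at a point of the ball. [cite: MochizukiAbsTopIII2015, Definition 2.1 (i) p.50] -/
theorem extend_apply_of_mem {β : Type*} (S : unitDiscOpens → β) (b : β) {z : ℂ} (hz : z ∈ ball (0 : ℂ) 1) :
    Function.extend Subtype.val S (fun _ => b) z = S ⟨z, hz⟩ :=
  extend_apply_coe S b ⟨z, hz⟩

/-- A `ℂ`-differentiable self-map of `unitDiscOpens` has holomorphic total extension on the ball.
[cite: MochizukiAbsTopIII2015, Definition 2.1 (i) p.50] -/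
theorem differentiableOn_extend_of_mdifferentiable {S : unitDiscOpens → unitDiscOpens}
    (hS : MDifferentiable 𝓘(ℂ, ℂ) 𝓘(ℂ, ℂ) S) :
    DifferentiableOn ℂ (Function.extend Subtype.val (Subtype.val ∘ S) (fun _ => 0)) (ball 0 1) := by
  intro z hz
  have hx := hS ⟨z, hz⟩
  rw [mdifferentiableAt_opens_iff (Φ := Function.extend Subtype.val (Subtype.val ∘ S) fun _ => 0)
    (fun x => (extend_apply_coe (Subtype.val ∘ S) (0 : ℂ) x).symm)] at hx
  exact (mdifferentiableAt_iff_differentiableAt.1 hx).differentiableWithinAt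

/-- A `ℂ`-differentiable map `unitDiscOpens → ℂ` has holomorphic total extension on the ball
(pointwise form). [cite: MochizukiAbsTopIII2015, Definition 2.1 (i) p.50] -/
theorem differentiableAt_extend_of_mdifferentiableAt {A : unitDiscOpens → ℂ} {x : unitDiscOpens}
    (hA : MDifferentiableAt 𝓘(ℂ, ℂ) 𝓘(ℂ, ℂ) A x) :
    DifferentiableAt ℂ (Function.extend Subtype.val A (fun _ => 0)) x := by
  rw [mdifferentiableAt_opens_dom_iff (Φ := Function.extend Subtype.val A fun _ => 0)
    (fun x => (extend_apply_coe A (0 : ℂ) x).symm)] at hA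
  exact mdifferentiableAt_iff_differentiableAt.1 hA

/-- A self-map of `unitDiscOpens` restricting a holomorphic function is `ℂ`-differentiable.
[cite: MochizukiAbsTopIII2015, Definition 2.1 (i) p.50] -/
theorem mdifferentiable_of_differentiableOn {f : ℂ → ℂ} (hf : DifferentiableOn ℂ f (ball 0 1))
    {S : unitDiscOpens → unitDiscOpens} (hS : ∀ x, (S x : ℂ) = f x) :
    MDifferentiable 𝓘(ℂ, ℂ) 𝓘(ℂ, ℂ) S := by
  intro x
  rw [mdifferentiableAt_opens_iff (Φ := f) hS]
  exact mdifferentiableAt_iff_differentiableAt.2 (hf.differentiableAt (isOpen_ball.mem_nhds x.2))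

/-- A map into `unitDiscOpens` whose composite with the inclusion is differentiable at a point is
`ℂ`-differentiable there (ambient source `ℂ`). [cite: MochizukiAbsTopIII2015, Definition 2.1 (i) p.50] -/
theorem differentiableAt_val_comp_of_mdifferentiableAt {B : ℂ → unitDiscOpens} {w : ℂ}
    (hB : MDifferentiableAt 𝓘(ℂ, ℂ) 𝓘(ℂ, ℂ) B w) :
    DifferentiableAt ℂ (Subtype.val ∘ B) w :=
  mdifferentiableAt_iff_differentiableAt.1 ((mdifferentiableAt_opens_cod_iff w).1 hB)

/-- The total extension of a continuous self-map of `unitDiscOpens` is continuous on the ball.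
[cite: MochizukiAbsTopIII2015, Definition 2.1 (i) p.50] -/
theorem continuousOn_extend {S : unitDiscOpens → unitDiscOpens} (hS : Continuous S) :
    ContinuousOn (Function.extend Subtype.val (Subtype.val ∘ S) (fun _ => (0 : ℂ))) (ball 0 1) := by
  rw [isOpen_ball.continuousOn_iff]
  intro z hz
  have key : ContinuousAt ((Function.extend Subtype.val (Subtype.val ∘ S) fun _ => (0 : ℂ)) ∘
      (Subtype.val : unitDiscOpens → ℂ)) ⟨z, hz⟩ := by
    have : (Function.extend Subtype.val (Subtype.val ∘ S) fun _ => (0 : ℂ)) ∘ Subtype.val =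
        Subtype.val ∘ S := funext fun x => extend_apply_coe _ _ x
    rw [this]
    exact (continuous_subtype_val.comp hS).continuousAt
  exact (unitDiscOpens.isOpenEmbedding'.continuousAt_iff).1 key

/-- The total extension of a self-map of `unitDiscOpens` maps the ball into the ball.
[cite: MochizukiAbsTopIII2015, Definition 2.1 (i) p.50] -/
theorem mapsTo_extend (S : unitDiscOpens → unitDiscOpens) :
    MapsTo (Function.extend Subtype.val (Subtype.val ∘ S) (fun _ => (0 : ℂ))) (ball 0 1) (ball 0 1) := by
  intro z hz
  rw [extend_apply_of_mem _ _ hz]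
  exact (S ⟨z, hz⟩).2

/-! ### Automorphisms of the disc as homeomorphisms of `unitDiscOpens` -/

/-- A holomorphic automorphism of the disc (`IsDiscAut`, a total function with a holomorphic
two-sided inverse on the ball) induces a self-homeomorphism of `unitDiscOpens` that is
`ℂ`-differentiable together with its inverse. [cite: MochizukiAbsTopIII2015, Definition 2.1 (i) p.50] -/
theorem exists_homeomorph_unitDiscOpens_of_isDiscAut {f : ℂ → ℂ} (hf : IsDiscAut f) :
    ∃ (T : unitDiscOpens ≃ₜ unitDiscOpens) (g : ℂ → ℂ), IsDiscAut g ∧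
      (∀ x, (T x : ℂ) = f x) ∧ (∀ x, (T.symm x : ℂ) = g x) ∧
      (∀ z ∈ ball (0 : ℂ) 1, g (f z) = z) ∧ (∀ z ∈ ball (0 : ℂ) 1, f (g z) = z) ∧
      MDifferentiable 𝓘(ℂ, ℂ) 𝓘(ℂ, ℂ) T ∧ MDifferentiable 𝓘(ℂ, ℂ) 𝓘(ℂ, ℂ) T.symm := by
  obtain ⟨g, hgd, hgm, hgf, hfg⟩ := hf.exists_inverse
  have hgaut : IsDiscAut g := IsDiscAut.symm hf.differentiableOn hf.mapsTo hgd hgm hgf hfg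
  let toF : unitDiscOpens → unitDiscOpens := fun x => ⟨f x, hf.mapsTo x.2⟩
  let invF : unitDiscOpens → unitDiscOpens := fun x => ⟨g x, hgm x.2⟩
  have hc1 : Continuous toF :=
    (hf.continuousOn.comp_continuous continuous_subtype_val fun x => x.2).subtype_mk _
  have hc2 : Continuous invF :=
    (hgd.continuousOn.comp_continuous continuous_subtype_val fun x => x.2).subtype_mk _
  let T : unitDiscOpens ≃ₜ unitDiscOpens :=
    { toFun := toF
      invFun := invF
      left_inv := fun x => Subtype.ext (hgf x x.2)
      right_inv := fun x => Subtype.ext (hfg x x.2)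
      continuous_toFun := hc1
      continuous_invFun := hc2 }
  refine ⟨T, g, hgaut, fun x => rfl, fun x => rfl, hgf, hfg,
    mdifferentiable_of_differentiableOn hf.differentiableOn (S := T) fun x => rfl,
    mdifferentiable_of_differentiableOn hgd (S := T.symm) fun x => rfl⟩

/-! ### Restriction to `⊤ : Opens X` and connectedness -/

section Top

variable {X : Type*} [TopologicalSpace X] {Y : Type*} [TopologicalSpace Y]

/-- A homeomorphism `X ≃ₜ Y` restricts to a homeomorphism of the open subsets `⊤`.
[cite: MochizukiAbsTopIII2015, Definition 2.1 (ii) p.51] -/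
theorem exists_homeomorph_top (F : X ≃ₜ Y) :
    ∃ ψ : (⊤ : Opens X) ≃ₜ (⊤ : Opens Y), (∀ x, (ψ x : Y) = F x) ∧ ∀ y, (ψ.symm y : X) = F.symm y := by
  let ψ : (⊤ : Opens X) ≃ₜ (⊤ : Opens Y) :=
    { toFun := fun x => ⟨F x, trivial⟩
      invFun := fun y => ⟨F.symm y, trivial⟩
      left_inv := fun x => Subtype.ext (F.symm_apply_apply x)
      right_inv := fun y => Subtype.ext (F.apply_symm_apply y)
      continuous_toFun := (F.continuous.comp continuous_subtype_val).subtype_mk _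
      continuous_invFun := (F.symm.continuous.comp continuous_subtype_val).subtype_mk _ }
  exact ⟨ψ, fun x => rfl, fun y => rfl⟩

end Top

/-- `unitDiscOpens` is connected. [cite: MochizukiAbsTopIII2015, Definition 2.1 (i) p.50] -/
theorem connectedSpace_unitDiscOpens : ConnectedSpace unitDiscOpens :=
  isConnected_iff_connectedSpace.1 ((convex_ball (0 : ℂ) 1).isConnected ⟨0, mem_ball_self one_pos⟩)

/-- An Aut-holomorphic disc is connected: `⊤ : Opens X` is a connected open.
[cite: MochizukiAbsTopIII2015, Definition 2.1 (i) p.50] -/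
theorem isConnected_top_of_isAutHolDisc {X : Type*} [TopologicalSpace X] [ChartedSpace ℂ X]
    (hX : IsAutHolDisc X) : IsConnected ((⊤ : Opens X) : Set X) := by
  obtain ⟨e, -, -⟩ := hX.exists_biholomorphic
  haveI := connectedSpace_unitDiscOpens
  have h1 : IsConnected (univ : Set unitDiscOpens) := isConnected_univ
  have h2 : IsConnected (e.symm '' (univ : Set unitDiscOpens)) :=
    h1.image _ e.symm.continuous.continuousOn
  rw [image_univ, e.symm.range_coe] at h2
  rwa [Opens.coe_top]

end Literature.AnabelianGeometry.AbsoluteAnabelian
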